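import Mathlib.Algebra.BigOperators.Ring.Finset
import Mathlib.Algebra.Group.Pointwise.Finset.Basic
import Mathlib.Algebra.Field.ZMod
import Mathlib.Tactic.Abel
import Mathlib.Tactic.Ring
import Summits.MatrixMultiplication.OmegaCensus.ThreeSetAffineSpan
import Summits.MatrixMultiplication.OmegaCensus.ThreeSetPartThreeNormalForm
import HarnessLib

/-!
# The tiling form of a three-set cube form; a part of size `3` over `ℤ_p²` is a triangle factor of the punctured torus

ω-census `pub-omega`, family (b3), seat pub-omega-group gen 32.  Framing: lottery ticket; floor = certified bounds/negative
ranges.  VALUE: kernel structure theorems about the group-theoretic method; NOT progress on ω.  Continuation of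
`ThreeSetAffineSpan.lean` / `ThreeSetPartThreeNormalForm.lean`.

* **`cube_form_tiling`** (any finite abelian `A`, `W` non-empty).  A cube symmetric form `(W, X, Y, x₀)` is a TILING of
  `A ∖ {x₀}` by translates of `−W` and `W`: with `M := X + Y` (`|M| = |X||Y|`) and `T := (Y − X) ⊔ (X − Y)` (`|T| = 2|X||Y|`),
  every `a ≠ x₀` lies in exactly one of the sets `−W + m` (`m ∈ M`), `W + t` (`t ∈ T`), and `x₀` in none:
  `#{m ∈ M : m − a ∈ W} + #{t ∈ T : a − t ∈ W} = [a ≠ x₀]`.  (RESULTS-g31 §1 stated this 'tiling form' without proof.)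
* **`triangle_factor_of_part_three`** (`A = ℤ_p × ℤ_p`).  If `|W| = 3`, then (after the affine normal form
  `cube_form_part_three_normal_form`) there are `T, M ⊆ ℤ_p²` and `z₀` with
  `#{m ∈ M : m − a ∈ {0,e₁,e₂}} + #{t ∈ T : a − t ∈ {0,e₁,e₂}} = [a ≠ z₀]` for all `a`, `|T| = 2|M|` and `9|M| + 1 = p²`:
  a partition of the punctured discrete torus into `|T|` up-triangles `{t, t+e₁, t+e₂}` and `|M|` down-triangles
  `{m, m−e₁, m−e₂}` with `#up − #down = (p² − 1)/9` — the exact hypothesis of the cell's triangle-factor statement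
  (RESULTS-g32: `|#up − #down| ≤ (10p+6)/9` for every such partition, paper grade), which therefore excludes parts of size `3`.

No new definitions.
-/

namespace Summit.MatrixMultiplication.OmegaCensus

open Finset

section Tiling

variable {A : Type*} [AddCommGroup A] [DecidableEq A]

/-- Counting `−w + x + y = a` over the box through `m = x + y`: a bijection with `{m ∈ X + Y : m − a ∈ W}`. [folklore] -/
theorem card_filter_neg_add_add_eq (W X Y : Finset A) (a : A)
    (hinj : Set.InjOn (fun q : A × A => q.1 + q.2) ↑(X ×ˢ Y)) :
    ((W ×ˢ X ×ˢ Y).filter fun p : A × A × A => -p.1 + p.2.1 + p.2.2 = a).card =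
      (((X ×ˢ Y).image fun q : A × A => q.1 + q.2).filter fun m => m - a ∈ W).card := by
  refine card_bij (fun p _ => p.2.1 + p.2.2) ?_ ?_ ?_
  · rintro ⟨w, x, y⟩ hp
    simp only [mem_filter, mem_product] at hp
    simp only [mem_filter, mem_image, mem_product]
    refine ⟨⟨(x, y), ⟨hp.1.2.1, hp.1.2.2⟩, rfl⟩, ?_⟩
    rw [show x + y - a = w by rw [← hp.2]; abel]; exact hp.1.1
  · rintro ⟨w, x, y⟩ hp ⟨w', x', y'⟩ hp' h
    simp only [mem_filter, mem_product] at hp hp'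
    simp only at h
    have hxy : (x, y) = (x', y') :=
      hinj (mem_coe.2 (mem_product.2 ⟨hp.1.2.1, hp.1.2.2⟩)) (mem_coe.2 (mem_product.2 ⟨hp'.1.2.1, hp'.1.2.2⟩)) h
    obtain ⟨rfl, rfl⟩ := Prod.mk.inj hxy
    have hw : w = w' := by
      have e₁ := hp.2; have e₂ := hp'.2
      rw [← e₂] at e₁
      have : -w = -w' := add_right_cancel (add_right_cancel e₁)
      exact neg_injective this
    rw [hw]
  · intro m hm
    simp only [mem_filter, mem_image, mem_product] at hm
    obtain ⟨⟨⟨x, y⟩, ⟨hx, hy⟩, rfl⟩, hW⟩ := hm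
    refine ⟨(x + y - a, x, y), ?_, rfl⟩
    simp only [mem_filter, mem_product]
    exact ⟨⟨hW, hx, hy⟩, by abel⟩

/-- Counting `w − x + y = a` over the box through `t = y − x`: a bijection with `{t ∈ Y − X : a − t ∈ W}`. [folklore] -/
theorem card_filter_sub_add_eq (W X Y : Finset A) (a : A)
    (hinj : Set.InjOn (fun q : A × A => q.2 - q.1) ↑(X ×ˢ Y)) :
    ((W ×ˢ X ×ˢ Y).filter fun p : A × A × A => p.1 - p.2.1 + p.2.2 = a).card =
      (((X ×ˢ Y).image fun q : A × A => q.2 - q.1).filter fun t => a - t ∈ W).card := by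
  refine card_bij (fun p _ => p.2.2 - p.2.1) ?_ ?_ ?_
  · rintro ⟨w, x, y⟩ hp
    simp only [mem_filter, mem_product] at hp
    simp only [mem_filter, mem_image, mem_product]
    refine ⟨⟨(x, y), ⟨hp.1.2.1, hp.1.2.2⟩, rfl⟩, ?_⟩
    rw [show a - (y - x) = w by rw [← hp.2]; abel]; exact hp.1.1
  · rintro ⟨w, x, y⟩ hp ⟨w', x', y'⟩ hp' h
    simp only [mem_filter, mem_product] at hp hp'
    simp only at h
    have hxy : (x, y) = (x', y') :=
      hinj (mem_coe.2 (mem_product.2 ⟨hp.1.2.1, hp.1.2.2⟩)) (mem_coe.2 (mem_product.2 ⟨hp'.1.2.1, hp'.1.2.2⟩)) h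
    obtain ⟨rfl, rfl⟩ := Prod.mk.inj hxy
    have hw : w = w' := by
      have e₁ := hp.2; have e₂ := hp'.2
      rw [← e₂] at e₁
      exact sub_left_injective (add_right_cancel e₁)
    rw [hw]
  · intro t ht
    simp only [mem_filter, mem_image, mem_product] at ht
    obtain ⟨⟨⟨x, y⟩, ⟨hx, hy⟩, rfl⟩, hW⟩ := ht
    refine ⟨(a - (y - x), x, y), ?_, rfl⟩
    simp only [mem_filter, mem_product]
    exact ⟨⟨hW, hx, hy⟩, by abel⟩

/-- Counting `w + x − y = a` over the box through `t = x − y`: a bijection with `{t ∈ X − Y : a − t ∈ W}`. [folklore] -/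
theorem card_filter_add_sub_eq (W X Y : Finset A) (a : A)
    (hinj : Set.InjOn (fun q : A × A => q.1 - q.2) ↑(X ×ˢ Y)) :
    ((W ×ˢ X ×ˢ Y).filter fun p : A × A × A => p.1 + p.2.1 - p.2.2 = a).card =
      (((X ×ˢ Y).image fun q : A × A => q.1 - q.2).filter fun t => a - t ∈ W).card := by
  refine card_bij (fun p _ => p.2.1 - p.2.2) ?_ ?_ ?_
  · rintro ⟨w, x, y⟩ hp
    simp only [mem_filter, mem_product] at hp
    simp only [mem_filter, mem_image, mem_product]
    refine ⟨⟨(x, y), ⟨hp.1.2.1, hp.1.2.2⟩, rfl⟩, ?_⟩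
    rw [show a - (x - y) = w by rw [← hp.2]; abel]; exact hp.1.1
  · rintro ⟨w, x, y⟩ hp ⟨w', x', y'⟩ hp' h
    simp only [mem_filter, mem_product] at hp hp'
    simp only at h
    have hxy : (x, y) = (x', y') :=
      hinj (mem_coe.2 (mem_product.2 ⟨hp.1.2.1, hp.1.2.2⟩)) (mem_coe.2 (mem_product.2 ⟨hp'.1.2.1, hp'.1.2.2⟩)) h
    obtain ⟨rfl, rfl⟩ := Prod.mk.inj hxy
    have hw : w = w' := by
      have e₁ := hp.2; have e₂ := hp'.2
      rw [← e₂] at e₁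
      have : w + x = w' + x := sub_left_injective e₁
      exact add_right_cancel this
    rw [hw]
  · intro t ht
    simp only [mem_filter, mem_image, mem_product] at ht
    obtain ⟨⟨⟨x, y⟩, ⟨hx, hy⟩, rfl⟩, hW⟩ := ht
    refine ⟨(a - (x - y), x, y), ?_, rfl⟩
    simp only [mem_filter, mem_product]
    exact ⟨⟨hW, hx, hy⟩, by abel⟩

variable [Fintype A]

/-- **Tiling form of the cube symmetric form.**  With `M = X + Y` and `T = (Y − X) ∪ (X − Y)` (a disjoint union), every
`a ≠ x₀` is covered exactly once by the translates `−W + m` (`m ∈ M`) and `W + t` (`t ∈ T`), and `x₀` is not covered;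
`|M| = |X||Y|`, `|T| = 2|X||Y|`. [folklore] -/
theorem cube_form_tiling {W X Y : Finset A} {x₀ : A} (hW : W.Nonempty)
    (h₁ : Set.InjOn (fun p : A × A × A => -p.1 + p.2.1 + p.2.2) ↑(W ×ˢ X ×ˢ Y))
    (h₂ : Set.InjOn (fun p : A × A × A => p.1 - p.2.1 + p.2.2) ↑(W ×ˢ X ×ˢ Y))
    (h₃ : Set.InjOn (fun p : A × A × A => p.1 + p.2.1 - p.2.2) ↑(W ×ˢ X ×ˢ Y))
    (d₁₂ : Disjoint ((W ×ˢ X ×ˢ Y).image fun p : A × A × A => -p.1 + p.2.1 + p.2.2)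
      ((W ×ˢ X ×ˢ Y).image fun p : A × A × A => p.1 - p.2.1 + p.2.2))
    (d₁₃ : Disjoint ((W ×ˢ X ×ˢ Y).image fun p : A × A × A => -p.1 + p.2.1 + p.2.2)
      ((W ×ˢ X ×ˢ Y).image fun p : A × A × A => p.1 + p.2.1 - p.2.2))
    (d₂₃ : Disjoint ((W ×ˢ X ×ˢ Y).image fun p : A × A × A => p.1 - p.2.1 + p.2.2)
      ((W ×ˢ X ×ˢ Y).image fun p : A × A × A => p.1 + p.2.1 - p.2.2))
    (hcover : ((W ×ˢ X ×ˢ Y).image fun p : A × A × A => -p.1 + p.2.1 + p.2.2) ∪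
      ((W ×ˢ X ×ˢ Y).image fun p : A × A × A => p.1 - p.2.1 + p.2.2) ∪
      ((W ×ˢ X ×ˢ Y).image fun p : A × A × A => p.1 + p.2.1 - p.2.2) = univ.erase x₀) :
    let M := (X ×ˢ Y).image fun q : A × A => q.1 + q.2
    let T := ((X ×ˢ Y).image fun q : A × A => q.2 - q.1) ∪ ((X ×ˢ Y).image fun q : A × A => q.1 - q.2)
    (∀ a : A, (M.filter fun m => m - a ∈ W).card + (T.filter fun t => a - t ∈ W).card = if a = x₀ then 0 else 1) ∧
      Disjoint ((X ×ˢ Y).image fun q : A × A => q.2 - q.1) ((X ×ˢ Y).image fun q : A × A => q.1 - q.2) ∧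
      M.card = X.card * Y.card ∧ T.card = 2 * (X.card * Y.card) := by
  intro M T
  obtain ⟨w₀, hw₀⟩ := hW
  have mem3 : ∀ {q : A × A}, q ∈ (X ×ˢ Y : Finset (A × A)) → (w₀, q) ∈ W ×ˢ X ×ˢ Y :=
    fun hq => mem_product.2 ⟨hw₀, hq⟩
  have i₁ : Set.InjOn (fun q : A × A => q.1 + q.2) ↑(X ×ˢ Y) := by
    intro q hq q' hq' h
    have := h₁ (mem_coe.2 (mem3 (mem_coe.1 hq))) (mem_coe.2 (mem3 (mem_coe.1 hq')))
      (by show -w₀ + q.1 + q.2 = -w₀ + q'.1 + q'.2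
          rw [add_assoc, show q.1 + q.2 = q'.1 + q'.2 from h, ← add_assoc])
    exact (Prod.mk.inj this).2
  have i₂ : Set.InjOn (fun q : A × A => q.2 - q.1) ↑(X ×ˢ Y) := by
    intro q hq q' hq' h
    have := h₂ (mem_coe.2 (mem3 (mem_coe.1 hq))) (mem_coe.2 (mem3 (mem_coe.1 hq')))
      (by show w₀ - q.1 + q.2 = w₀ - q'.1 + q'.2
          rw [show w₀ - q.1 + q.2 = w₀ + (q.2 - q.1) by abel, show q.2 - q.1 = q'.2 - q'.1 from h,
            show w₀ + (q'.2 - q'.1) = w₀ - q'.1 + q'.2 by abel])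
    exact (Prod.mk.inj this).2
  have i₃ : Set.InjOn (fun q : A × A => q.1 - q.2) ↑(X ×ˢ Y) := by
    intro q hq q' hq' h
    have := h₃ (mem_coe.2 (mem3 (mem_coe.1 hq))) (mem_coe.2 (mem3 (mem_coe.1 hq')))
      (by show w₀ + q.1 - q.2 = w₀ + q'.1 - q'.2
          rw [show w₀ + q.1 - q.2 = w₀ + (q.1 - q.2) by abel, show q.1 - q.2 = q'.1 - q'.2 from h,
            show w₀ + (q'.1 - q'.2) = w₀ + q'.1 - q'.2 by abel])
    exact (Prod.mk.inj this).2
  have dT : Disjoint ((X ×ˢ Y).image fun q : A × A => q.2 - q.1) ((X ×ˢ Y).image fun q : A × A => q.1 - q.2) := by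
    refine disjoint_left.2 fun t ht ht' => ?_
    obtain ⟨⟨x, y⟩, hq, rfl⟩ := mem_image.1 ht
    obtain ⟨⟨x', y'⟩, hq', he⟩ := mem_image.1 ht'
    refine disjoint_left.1 d₂₃ (mem_image.2 ⟨(w₀, x, y), mem3 hq, rfl⟩) (mem_image.2 ⟨(w₀, x', y'), mem3 hq', ?_⟩)
    show w₀ + x' - y' = w₀ - x + y
    simp only at he
    rw [add_sub_assoc, he]; abel
  refine ⟨fun a => ?_, dT, by rw [card_image_of_injOn i₁, card_product], ?_⟩
  · rw [← cube_form_count_eq h₁ h₂ h₃ d₁₂ d₁₃ d₂₃ hcover a, card_filter_neg_add_add_eq W X Y a i₁,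
      card_filter_sub_add_eq W X Y a i₂, card_filter_add_sub_eq W X Y a i₃, add_assoc]
    congr 1
    show (filter (fun t => a - t ∈ W) (((X ×ˢ Y).image fun q : A × A => q.2 - q.1) ∪
      ((X ×ˢ Y).image fun q : A × A => q.1 - q.2))).card = _
    rw [filter_union, card_union_of_disjoint (disjoint_filter_filter dT)]
  · show (((X ×ˢ Y).image fun q : A × A => q.2 - q.1) ∪ ((X ×ˢ Y).image fun q : A × A => q.1 - q.2)).card = _
    rw [card_union_of_disjoint dT, card_image_of_injOn i₂, card_image_of_injOn i₃, card_product, two_mul]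

end Tiling

section Plane

variable {p : ℕ} [Fact p.Prime]

/-- **A part of size 3 over `ℤ_p × ℤ_p` is a triangle factor of the punctured torus.**  If a cube symmetric form over
`ℤ_p²` has `|W| = 3`, there are `T, M ⊆ ℤ_p²` and `z₀` such that the up-triangles `{t, t+e₁, t+e₂}` (`t ∈ T`) and the
down-triangles `{m, m−e₁, m−e₂}` (`m ∈ M`) partition `ℤ_p² ∖ {z₀}`, with `|T| = 2|M|` and `9|M| + 1 = p²`
(so `#up − #down = (p² − 1)/9`). [folklore] -/
theorem triangle_factor_of_part_three {W X Y : Finset (ZMod p × ZMod p)} {x₀ : ZMod p × ZMod p}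
    (h₁ : Set.InjOn (fun q : (ZMod p × ZMod p) × (ZMod p × ZMod p) × (ZMod p × ZMod p) => -q.1 + q.2.1 + q.2.2)
      ↑(W ×ˢ X ×ˢ Y))
    (h₂ : Set.InjOn (fun q : (ZMod p × ZMod p) × (ZMod p × ZMod p) × (ZMod p × ZMod p) => q.1 - q.2.1 + q.2.2)
      ↑(W ×ˢ X ×ˢ Y))
    (h₃ : Set.InjOn (fun q : (ZMod p × ZMod p) × (ZMod p × ZMod p) × (ZMod p × ZMod p) => q.1 + q.2.1 - q.2.2)
      ↑(W ×ˢ X ×ˢ Y))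
    (d₁₂ : Disjoint ((W ×ˢ X ×ˢ Y).image fun q => -q.1 + q.2.1 + q.2.2) ((W ×ˢ X ×ˢ Y).image fun q => q.1 - q.2.1 + q.2.2))
    (d₁₃ : Disjoint ((W ×ˢ X ×ˢ Y).image fun q => -q.1 + q.2.1 + q.2.2) ((W ×ˢ X ×ˢ Y).image fun q => q.1 + q.2.1 - q.2.2))
    (d₂₃ : Disjoint ((W ×ˢ X ×ˢ Y).image fun q => q.1 - q.2.1 + q.2.2) ((W ×ˢ X ×ˢ Y).image fun q => q.1 + q.2.1 - q.2.2))
    (hcover : ((W ×ˢ X ×ˢ Y).image fun q => -q.1 + q.2.1 + q.2.2) ∪ ((W ×ˢ X ×ˢ Y).image fun q => q.1 - q.2.1 + q.2.2) ∪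
      ((W ×ˢ X ×ˢ Y).image fun q => q.1 + q.2.1 - q.2.2) = univ.erase x₀)
    (hW : W.card = 3) :
    ∃ (T M : Finset (ZMod p × ZMod p)) (z₀ : ZMod p × ZMod p),
      (∀ a, (M.filter fun m => m - a ∈ ({0, (1, 0), (0, 1)} : Finset (ZMod p × ZMod p))).card +
          (T.filter fun t => a - t ∈ ({0, (1, 0), (0, 1)} : Finset (ZMod p × ZMod p))).card = if a = z₀ then 0 else 1) ∧
      T.card = 2 * M.card ∧ 9 * M.card + 1 = p ^ 2 := by
  obtain ⟨X', Y', z₀, m₁, m₂, m₃, f₁₂, f₁₃, f₂₃, mcov, cX, cY⟩ :=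
    cube_form_part_three_normal_form h₁ h₂ h₃ d₁₂ d₁₃ d₂₃ hcover hW
  have hne : ({0, (1, 0), (0, 1)} : Finset (ZMod p × ZMod p)).Nonempty := ⟨0, by simp⟩
  obtain ⟨htile, -, hM, hT⟩ := cube_form_tiling hne m₁ m₂ m₃ f₁₂ f₁₃ f₂₃ mcov
  refine ⟨_, _, z₀, htile, ?_, ?_⟩
  · rw [hT, hM]
  · rw [hM, cX, cY]
    exact (nine_mul_card_add_one_eq_sq h₁ h₂ h₃ d₁₂ d₁₃ d₂₃ hcover hW).1

end Plane

end Summit.MatrixMultiplication.OmegaCensus
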